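import Mathlib
import HarnessLib
import Literature.Analysis.FluidPDE.HardSphereDynamics
import Literature.MathematicalPhysics.KineticTheory.HardSphereEuler
import Summits.AtomisticToContinuum.HydrodynamicLimit.Theses.RelayRaceLocality
import Summits.AtomisticToContinuum.HydrodynamicLimit.Theorems.RelayRaceLocalityGibbsLightConeGhostVoid
import Summits.AtomisticToContinuum.HydrodynamicLimit.Theorems.GibbsLightCone.Negative.IdealGas

/-!
# What any proof of `RelayRaceLocality.GibbsLightCone` must contain: fast spheres do not fly free
# over a macroscopic time (stmt-AtomisticToContinuum-12501, helper `--supports`, necessity side)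

A kernel-checked form of the observation of leads c4/a1/a2 that the crux's `j = i` clause alone is an
N-uniform SURVIVAL-DECAY statement (seam D2 with the rate stripped): if `GibbsLightCone` holds with cone
data `(σ₀, c)`, then for every `0 < σ < σ₀`, every family of flows, every `t > 0` and `δ > 0`, the Gibbs
probability that SOME sphere whose speed lies in the window `(c + δ/t, 1/(2t))` suffers no contact during
`[0, t]` tends to `0` as `N → ∞`. Indeed such a sphere flies free (ghost lemma
`GhostNeedlePeeling.flow_apply_eq_freeFlight_of_forall_not_mem_contactSet`), does not wrap around the torus
(`GibbsLightConeWithoutPosDiameter.euclidDist_self_add_proj`, displacement `t‖v‖ < 1/2`), and so realises the crux event with `j = i`.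
For the ideal gas this probability is bounded below uniformly in `N` (the refutation
`gibbsLightCone_false_without_posDiameter`, `Negative/IdealGas.lean`), so this is exactly the place where
`0 < σ` (collisions) must be used; no printed theorem supplies such a decay at fixed reduced density
(`Cruxes/GibbsLightCone/Lines/SketchDead.md` §2, `Lines/IdeatorSixSketch.dead.md` §C).
-/

namespace Summit.AtomisticToContinuum.HydrodynamicLimit.Theorems.GhostNeedlePeeling

open Literature.Analysis.FluidPDE Literature.MathematicalPhysics.KineticTheory MeasureTheory Filter Set
open Literature.Analysis.FunctionSpaces (Torus.proj)
open scoped ENNReal Topology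

/-- **Free spheres realise the crux event.** On a good orbit, a sphere `i` with no contact during
`(0, t]` and displacement `t‖vᵢ‖ < 1/2` is, at time `t`, at minimal-image distance exactly `t‖vᵢ‖`
from its starting point. [folklore] -/
theorem euclidDist_flow_eq_of_forall_not_mem_contactSet {ε : ℝ} {N : ℕ}
    (Φ : HardSphereFlow (Torus.geometry (Fin 3)) ε (N + 1)) (i : Fin (N + 1)) {t : ℝ} (ht : 0 ≤ t)
    {z : Config (N + 1) (Fin 3) T3} (hz : z ∈ Φ.good)
    (hi : ∀ s ∈ Ioc 0 t, ∀ j : Fin (N + 1), j ≠ i →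
      Φ.flow s z ∉ contactSet (Torus.geometry (Fin 3)) (N + 1) ε i j)
    (hsmall : t * ‖(z i).2‖ < 1 / 2) :
    Torus.euclidDist (z i).1 (Φ.flow t z i).1 = t * ‖(z i).2‖ := by
  have hfree := flow_apply_eq_freeFlight_of_forall_not_mem_contactSet Φ i ht hz hi
  rw [sub_zero, Φ.flow_zero z hz] at hfree
  have hnorm : ‖t • (z i).2‖ = t * ‖(z i).2‖ := by rw [norm_smul, Real.norm_of_nonneg ht]
  rw [hfree, freeFlight_apply, Torus.geometry_translate, GibbsLightConeWithoutPosDiameter.euclidDist_self_add_proj _ (by rwa [hnorm]), hnorm]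

/-- **Necessity of survival decay.** If `GibbsLightCone` holds (cone data `σ₀, c`), then for all
`0 < σ < σ₀`, all flows, all `t > 0`, `δ > 0`: the Gibbs probability that some sphere with speed in
`(c + δ/t, 1/(2t))` has no contact during `[0, t]` tends to `0` — the `j = i` clause of the crux read on
collision-free spheres. [folklore] -/
theorem tendsto_freeFastSphere_of_gibbsLightCone :
    Summit.AtomisticToContinuum.HydrodynamicLimit.Theses.RelayRaceLocality.GibbsLightCone →
    ∀ a θ : ℝ, 0 < a → 0 < θ → ∃ σ₀ : ℝ, 0 < σ₀ ∧ ∃ c : ℝ, 0 < c ∧ ∀ σ : ℝ, 0 < σ → σ < σ₀ →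
      ∀ Φ : (N : ℕ) → HardSphereFlow (Torus.geometry (Fin 3)) (hsDiameter σ N) (N + 1),
      ∀ t : ℝ, 0 < t → ∀ δ : ℝ, 0 < δ →
        Tendsto (fun N => localGibbsLaw σ (fun _ => a) (fun _ => 0) (fun _ => θ) N (Φ N)
          {z | z ∈ (Φ N).good ∧ ∃ i : Fin (N + 1), c * t + δ < t * ‖(z i).2‖ ∧ t * ‖(z i).2‖ < 1 / 2 ∧
            ∀ u ∈ Set.Icc 0 t, ∀ j : Fin (N + 1), j ≠ i →
              (Φ N).flow u z ∉ contactSet (Torus.geometry (Fin 3)) (N + 1) (hsDiameter σ N) i j})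
          atTop (nhds 0) := by
  intro h a θ ha hθ
  obtain ⟨σ₀, hσ₀, c, hc, H⟩ := h a θ ha hθ
  refine ⟨σ₀, hσ₀, c, hc, fun σ hσ hσ' Φ t ht δ hδ => ?_⟩
  have hcrux := H σ hσ hσ' Φ t ht.le δ hδ
  refine tendsto_of_tendsto_of_tendsto_of_le_of_le tendsto_const_nhds hcrux (fun N => zero_le)
    (fun N => measure_mono ?_)
  rintro z ⟨hz, i, hfar, hsmall, hfree⟩
  refine ⟨i, i, Or.inl rfl, ?_⟩
  rw [euclidDist_flow_eq_of_forall_not_mem_contactSet (Φ N) i ht.le hz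
    (fun s hs => hfree s ⟨hs.1.le, hs.2⟩) hsmall]
  exact hfar

end Summit.AtomisticToContinuum.HydrodynamicLimit.Theorems.GhostNeedlePeeling
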